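import Summits.QuantumFields.BalabanUV.T4Continuum.Support.NE7MinimalOrbitQuadraticGrowth
import HarnessLib

/-!
# NE7CriticalOrbitQuadraticGrowthAnyDatum — QUADRATIC GROWTH OF THE WILSON ACTION OFF A CRITICAL ORBIT, FOR EVERY DATUM, UNIFORMLY IN THE LEVEL: gen 113's H8
# (`NE7MinimalOrbitQuadraticGrowth.action_quadratic_growth`, stated over the small data through the (8)∃ minimiser) with the datum hypothesis REMOVED — for every `U(n)`,
# every `L ≥ 2`, `d = 4`, there is `c₀ = c₀(n, L) > 0` such that for `0 < ε ≤ ε₀(n, L)`, `N ≥ 1`, ANY datum `V`, any level `j+1` and ANY critical point `U₁` of the constrained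
# problem in `admissible (sfClass 4 L N ε) L (j+1) V` (by H10 ✓ p819585 the unique critical = minimal orbit), every admissible `U′` has a periodic unitary gauge copy
# `U′^{u} = U₁·e^{X}` with  `c₀·‖X‖_w² ≤ A(U′) − A(U₁)`  — strict convexity of the constrained problem transversally to the orbits at its critical point
# ([Balaban1985Variational] Sect. E TYPE), no smallness or regularity of the datum

Cell `pub-balaban`, rung (B)+1 sub-cell t4, lineage `b2b-balaban-t4-ne7-p1` (CRUX PROVER NE7 #1 = OWNER of BINDER row NE7), generation 113.  Memo
`t4/b2b-balaban-t4-ne7-p1-g113/ROAD-G113.md` §5bis.  The proof of H8 verbatim with the centre `U♯` (the (8)∃ minimiser, tangent-critical by Fermat) replaced by a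
HYPOTHESISED critical point `U₁`; the margin line `NE7MinimalOrbitQuadraticGrowth.line_margin_of_small_card` is imported.
WHAT ([folklore]; 0 def, 0 sorry; `d = 4`, every `U(n)`, every `L ≥ 2`).  **`action_quadratic_growth_any_datum`**: `∃ c₀ > 0, ∃ ε₀ > 0, ∀ 0 < ε ≤ ε₀, ∀ N ≥ 1, ∀ V j, ∀ U₁ ∈
admissible (sfClass 4 L N ε) L (j+1) V, (U₁ tangent-critical at level j+1) → ∀ U′ ∈ admissible …, ∃ u X, IsUnitarySite u ∧ IsPeriodicSite u (N·L^{j+1}) ∧ IsSkewDir X ∧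
IsPeriodicDir X (N·L^{j+1}) ∧ gaugeAct u U′ = vary U₁ X 1 ∧ c₀ · energyNormW L (j+1) U₁ X (periodBox (N·L^{j+1}))² ≤ fineAction U′ (perWin 4 (N·L^{j+1})) − fineAction U₁ (perWin
4 (N·L^{j+1}))`.
HONEST FRAMING (page 1): composition of landed kernel theorems; `c₀(n, L) = 1∕(64(2 + C_E)·card n)` existential in the statement; weighted-energy currency, NOT a sup norm; nothing
of Bałaban's asserted as an axiom and NOT his method; finite 4-torus; NOT NE7 as a spine node (dagwriter∕referees' call), NOT NE3; spine 0∕9; NOT infinite volume, NOT mass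
gap, NOT BetaPertH, NOT Clay (continuum YM on T⁴ ⇐ BetaPertH ∧ nine spine estimates).
-/

set_option autoImplicit false

open scoped BigOperators Matrix Matrix.Norms.L2Operator
open NormedSpace Finset Set

namespace Summit.QuantumFields.BalabanUV.T4Continuum.NE7CriticalOrbitQuadraticGrowthAnyDatum

open Literature.MathematicalPhysics.QuantumFieldTheory.Balaban1983to89
open B7Prop1Explicit B7Prop2Explicit
open T4AveragingDeficitWall (IsUnitaryCfg IsSkewDir SmallField fineAction vary curl curlSq dirSq)
open T4AveragingDeficitWallBoundary (IsPeriodicCfg periodBox)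
open AveragingDeficitPeriodicCounting (IsPeriodicDir)
open AveragingDeficitMultiLevelPrep (LevelSmall TangentIter tower)
open AveragingDeficitMultiLevelBridge (tower_eq)
open MinimalActionLevels (perWin levelAction)
open MinimalActionSandwich (IsMinimiser admissible)
open MinimalActionRate (sfClass)
open NE3HessForm (hess dAction)
open NE3HessShapes (plaqsOf)
open NE3SlicePoincareShape (SlicePoincare slicePoincare_mono)
open NE3EnergyShapes (IsUnitarySite IsPeriodicSite)
open NE3EnergyWeightedShapes (energyNormW energyNormW_nonneg)
open NE3EnergyAssembly (fineAction_gaugeAct)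
open NE7MeanZeroGaugeSliceW (energyBlockLandauW)
open NE7ConvOneStepGenericSlice (hT_energyBlockLandau)
open NE7PairDecompNL0Generic (decomp_of_nl0_pair_generic)
open NE7EnergyRateWGeneric (line_of_small_card kfree_coercivity_card)
open NE7EnergyClassPoincareGeneric (classPackage)
open NE7SegmentPlaquetteRadius (smallField_vary_segment_class)
open NE7OneStepLetters (dAction_ge_of_tangent_critical)
open NE7ConvOneStepWeighted (curlSq_ge_weighted hess_vary_ge_weighted)
open NE7ConvOneStepUnique (fineAction_vary_sub_ge)
open BlockAverageCurrent (smallField_gaugeAct)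
open NE7MinimalOrbitQuadraticGrowth (line_margin_of_small_card)

noncomputable section

variable {n : Type} [Fintype n] [DecidableEq n]

/-! ## Quadratic growth off a critical orbit, any datum -/

/-- **QUADRATIC GROWTH OF THE ACTION OFF A CRITICAL ORBIT, ANY DATUM, UNIFORMLY IN THE LEVEL, EVERY `U(n)`, EVERY `L ≥ 2`, `d = 4`** (statement and argument in the file
header). [folklore] -/
theorem action_quadratic_growth_any_datum [Nonempty n] {L : ℕ} (hL : 2 ≤ L) :
    ∃ c₀ : ℝ, 0 < c₀ ∧ ∃ ε₀ : ℝ, 0 < ε₀ ∧ ∀ ε : ℝ, 0 < ε → ε ≤ ε₀ → ∀ (N : ℕ) [NeZero N], 1 ≤ N →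
      ∀ (V : Site 4 → Fin 4 → (Matrix n n ℂ)ˣ) (j : ℕ), ∀ U₁ ∈ admissible (sfClass 4 L N ε) L (j + 1) V,
        (∀ φ : Site 4 → Fin 4 → Matrix n n ℂ, IsSkewDir φ → IsPeriodicDir φ ((N * L ^ (j + 1) : ℕ) : ℤ) →
            TangentIter L j U₁ φ → dAction U₁ φ (perWin 4 (N * L ^ (j + 1))) = 0) →
        ∀ U' ∈ admissible (sfClass 4 L N ε) L (j + 1) V,
          ∃ (u : Site 4 → (Matrix n n ℂ)ˣ) (X : Site 4 → Fin 4 → Matrix n n ℂ),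
            IsUnitarySite u ∧ IsPeriodicSite u ((N * L ^ (j + 1) : ℕ) : ℤ) ∧ IsSkewDir X ∧ IsPeriodicDir X ((N * L ^ (j + 1) : ℕ) : ℤ) ∧
            gaugeAct u U' = vary U₁ X 1 ∧
            c₀ * energyNormW L (j + 1) U₁ X (periodBox (d := 4) (N * L ^ (j + 1))) ^ 2
              ≤ fineAction U' (perWin 4 (N * L ^ (j + 1))) - fineAction U₁ (perWin 4 (N * L ^ (j + 1))) := by
  haveI : NeZero L := ⟨by omega⟩
  have hL1 : 1 ≤ L := by omega
  have hL0 : (0 : ℝ) < L := by exact_mod_cast (show 0 < L by omega)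
  obtain ⟨ε₂, hε₂, CS, hCS, νc, hνc, κc, hκc, hdec⟩ := decomp_of_nl0_pair_generic (n := n) hL
  obtain ⟨θ₀, CF, CE, hθ₀, -, -, hCE, -, -, hlsP, -, hPE⟩ := classPackage (n := n) (d := 4) (by norm_num) hL
  -- the k-free line with the Poincaré constant `C_E + 1`, at HALF budget (margin)
  obtain ⟨CP, hCP⟩ : ∃ CP : ℝ, CP = CE + 1 := ⟨_, rfl⟩
  have hCP1 : 1 ≤ CP := by rw [hCP]; linarith
  have hCP0 : 0 < CP := by linarith
  obtain ⟨Q, hQ⟩ : ∃ Q : ℝ, Q = 2 * (1 + CP) := ⟨_, rfl⟩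
  have hQ4 : 4 ≤ Q := by rw [hQ]; linarith
  have hQ0 : 0 < Q := by linarith
  obtain ⟨cL, hcL⟩ : ∃ cL : ℝ, cL = 2 * κc + νc ^ 2 + 2304 * (CS ^ 2 * Real.exp (2 * CS)) + 112 * (1 + 7 * CS ^ 2) + 1 := ⟨_, rfl⟩
  have hcL0 : 0 < cL := by rw [hcL]; positivity
  have hcard1 : (1 : ℝ) ≤ (Fintype.card n : ℝ) := by exact_mod_cast Fintype.card_pos
  have hcard0 : (0 : ℝ) < (Fintype.card n : ℝ) := by linarith
  obtain ⟨ε₃, hε₃⟩ : ∃ ε₃ : ℝ, ε₃ = (1 / 2) / (2 * Q) / 4 / (Fintype.card n : ℝ) / cL := ⟨_, rfl⟩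
  have hε₃0 : 0 < ε₃ := by rw [hε₃]; positivity
  have hcard : (0 : ℝ) < 1000000000000000000000 * (L : ℝ) ^ 6 * (Fintype.card n : ℝ) := by positivity
  -- THE CONSTANT
  refine ⟨1 / (32 * Q * (Fintype.card n : ℝ)), by positivity,
    min ε₂ (min θ₀ (min (1 / (1000000000000000000000 * (L : ℝ) ^ 6 * (Fintype.card n : ℝ))) (min ε₃ 1))),
    lt_min hε₂ (lt_min hθ₀ (lt_min (by positivity) (lt_min hε₃0 one_pos))), ?_⟩
  intro ε hε hεle N _ hN
  have hεε₂ : ε ≤ ε₂ := hεle.trans (min_le_left _ _)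
  have hεθ₀ : ε ≤ θ₀ := hεle.trans ((min_le_right _ _).trans (min_le_left _ _))
  have hεθ : ε ≤ 1 / (1000000000000000000000 * (L : ℝ) ^ 6 * (Fintype.card n : ℝ)) :=
    hεle.trans ((min_le_right _ _).trans ((min_le_right _ _).trans (min_le_left _ _)))
  have hεε₃ : ε ≤ ε₃ := hεle.trans ((min_le_right _ _).trans ((min_le_right _ _).trans ((min_le_right _ _).trans (min_le_left _ _))))
  have hε1 : ε ≤ 1 := hεle.trans ((min_le_right _ _).trans ((min_le_right _ _).trans ((min_le_right _ _).trans (min_le_right _ _))))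
  have hθline : 1000000000000000000000 * (L : ℝ) ^ 6 * (Fintype.card n : ℝ) * ε ≤ 1 := by
    rw [le_div_iff₀ hcard] at hεθ; linarith
  have hsmall : cL * ε ≤ (1 / 2) / (2 * Q) / 4 / (Fintype.card n : ℝ) := by
    have h1 : cL * ε ≤ cL * ε₃ := mul_le_mul_of_nonneg_left hεε₃ hcL0.le
    have h2 : cL * ε₃ = (1 / 2) / (2 * Q) / 4 / (Fintype.card n : ℝ) := by rw [hε₃]; field_simp
    linarith only [h1, h2]
  have hline := line_margin_of_small_card (c := (Fintype.card n : ℝ)) hQ4 hcard1 hCS hκc hε hε1 (by rw [← hcL]; exact hsmall)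
  have hls : ∀ j : ℕ, LevelSmall 4 L j (ε / ((L : ℝ) ^ (j + 1)) ^ 2) := hlsP hε.le hεθ₀
  have hT : ∀ (j : ℕ) (W : Site 4 → Fin 4 → (Matrix n n ℂ)ˣ), W ∈ sfClass 4 L N ε (j + 1) → ∀ F : Finset (T4AveragingDeficitWall.Plaq 4),
      (∀ φ : Site 4 → Fin 4 → Matrix n n ℂ, IsSkewDir φ → IsPeriodicDir φ ((AveragingDeficitMultiLevelPrep.tower L N (j + 1) : ℕ) : ℤ) →
        TangentIter L j W φ → dAction W φ F = 0) →
      ∀ Y ∈ energyBlockLandauW (d := 4) (n := n) L N (j + 1) W, dAction W Y F = 0 :=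
    fun j W hW F htan => hT_energyBlockLandau hL1 hε.le hls j W hW F htan
  have hP : ∀ (j : ℕ) (W : Site 4 → Fin 4 → (Matrix n n ℂ)ˣ), W ∈ sfClass 4 L N ε (j + 1) →
      SlicePoincare L (j + 1) W (energyBlockLandauW (d := 4) (n := n) L N (j + 1) W) CP (periodBox (d := 4) (N * L ^ (j + 1))) :=
    fun j W hW => slicePoincare_mono (hPE hN hε hεθ₀ j W hW) (by rw [hCP]; linarith)
  intro V j Us hmem hcrit U' hU'
  have hM1 : (1 : ℝ) ≤ (L : ℝ) ^ (j + 1) := one_le_pow₀ (by exact_mod_cast hL1)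
  obtain ⟨u, X, XT, XN, α, ν, κ, hu, huP, hXs, hXP, hα, hXα, hgauge, hXdec, hXT, -, hXN, hν, hNw, hN1, hαM, hνle, hκle⟩ :=
    hdec N ε hε hεε₂ hθline V j Us hmem U' hU'
  refine ⟨u, X, hu, huP, hXs, hXP, hgauge, ?_⟩
  -- the per-level convexity coefficient and its margin over `2κ`
  have hck := kfree_coercivity_card (c := (Fintype.card n : ℝ)) (ε := ε) hcard0 hCP0.le hM1 hν hνle hα hαM
  set cX : ℝ := ((((1 / 2 - ν ^ 2) / (2 * (1 + CP)) - ν ^ 2) / 2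
      - 576 * ((4 : ℕ) : ℝ) * (Real.exp α - 1) ^ 2 * ((L : ℝ) ^ (j + 1)) ^ 2) / (Fintype.card n : ℝ)
      - 28 * ((4 : ℕ) : ℝ) * (ε / ((L : ℝ) ^ (j + 1)) ^ 2 + 7 * α ^ 2) * ((L : ℝ) ^ (j + 1)) ^ 2) with hcXdef
  have hmargin : 2 * κ + 1 / (16 * Q * (Fintype.card n : ℝ)) ≤ cX := by
    rw [hQ] at hline ⊢
    have h2κ : 2 * κ ≤ 2 * (κc * ε) := by linarith
    push_cast at hck hline ⊢
    linarith
  -- the chain of `vary_eq_self_of_tanCritical_rep_generic`, stopped at the Taylor gap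
  have hN0 : 0 < N := hN
  have hM : 1 ≤ N * L ^ (j + 1) := Nat.mul_pos hN0 (Nat.pow_pos (by omega))
  have e : perWin 4 (N * L ^ (j + 1)) = plaqsOf (periodBox (d := 4) (N * L ^ (j + 1))) := rfl
  set a : ℝ := ε / ((L : ℝ) ^ (j + 1)) ^ 2 with hadef
  have ha : 0 ≤ a := by rw [hadef]; positivity
  have hUsU : IsUnitaryCfg Us := hmem.1.1
  have hUsa : SmallField Us a := hmem.1.2.2
  set E := energyNormW L (j + 1) Us X (periodBox (d := 4) (N * L ^ (j + 1))) ^ 2 with hEdef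
  have hE0 : 0 ≤ E := by rw [hEdef]; exact sq_nonneg _
  -- criticality on the slice part
  have htan : ∀ φ : Site 4 → Fin 4 → Matrix n n ℂ, IsSkewDir φ → IsPeriodicDir φ ((tower L N (j + 1) : ℕ) : ℤ) → TangentIter L j Us φ →
      dAction Us φ (perWin 4 (N * L ^ (j + 1))) = 0 := by
    intro φ hφs hφP hφT
    have hφP' : IsPeriodicDir φ ((N * L ^ (j + 1) : ℕ) : ℤ) := by rw [← tower_eq L N (j + 1)]; exact hφP
    exact hcrit φ hφs hφP' hφT
  have hcritXT : dAction Us XT (perWin 4 (N * L ^ (j + 1))) = 0 := hT j Us hmem.1 _ htan XT hXT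
  -- the weighted Poincaré letter
  have hNw2 : energyNormW L (j + 1) Us XN (periodBox (d := 4) (N * L ^ (j + 1))) ^ 2 ≤ ν ^ 2 * E := by
    have h0 := energyNormW_nonneg L (j + 1) Us XN (periodBox (d := 4) (N * L ^ (j + 1)))
    calc energyNormW L (j + 1) Us XN (periodBox (d := 4) (N * L ^ (j + 1))) ^ 2
        ≤ (ν * energyNormW L (j + 1) Us X (periodBox (d := 4) (N * L ^ (j + 1)))) ^ 2 := pow_le_pow_left₀ h0 hNw 2
      _ = ν ^ 2 * E := by rw [hEdef]; ring
  have hm := curlSq_ge_weighted hCP0.le (hP j Us hmem.1) hXdec hXT hNw2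
  -- the segment radius and the slop
  have h1 : SmallField (vary Us X 1) a := by
    rw [← hgauge]; exact smallField_gaugeAct hu hU'.1.2.2
  have hrad : ∀ t ∈ Icc (0 : ℝ) 1, SmallField (vary Us X t) (a + 7 * α ^ 2) := fun t ht =>
    smallField_vary_segment_class hUsU hXs hUsa h1 hXα ht
  have ha' : 0 ≤ a + 7 * α ^ 2 := add_nonneg ha (mul_nonneg (by norm_num) (sq_nonneg α))
  have hslop : -(κ * E) ≤ dAction Us X (plaqsOf (periodBox (d := 4) (N * L ^ (j + 1)))) := by
    have h := dAction_ge_of_tangent_critical hUsU hUsa hXdec hXN (perWin 4 (N * L ^ (j + 1))) hcritXT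
    rw [e] at h hN1
    linarith
  -- convexity on the segment and the Taylor gap
  have hconv : ∀ t ∈ Icc (0 : ℝ) 1, cX * E ≤ hess (vary Us X t) X X (plaqsOf (periodBox (d := 4) (N * L ^ (j + 1)))) := by
    intro t ht
    have h := hess_vary_ge_weighted hL1 hM hUsU hXs hXP hα hXα hm ht ha' (hrad t ht)
    rw [hcXdef, hEdef]
    push_cast at h ⊢
    linarith
  have hgap := fineAction_vary_sub_ge Us X (plaqsOf (periodBox (d := 4) (N * L ^ (j + 1)))) hconv hslop
  -- `A(U♯e^X) = A(U′)` and the margin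
  have hAeq : fineAction (vary Us X 1) (perWin 4 (N * L ^ (j + 1))) = fineAction U' (perWin 4 (N * L ^ (j + 1))) := by
    rw [← hgauge, fineAction_gaugeAct]
  rw [← hAeq, e]
  have hc₀ : 1 / (32 * Q * (Fintype.card n : ℝ)) ≤ cX / 2 - κ := by
    have e2 : 1 / (32 * Q * (Fintype.card n : ℝ)) = (1 / (16 * Q * (Fintype.card n : ℝ))) / 2 := by field_simp; ring
    rw [e2]; linarith
  calc 1 / (32 * Q * (Fintype.card n : ℝ)) * E ≤ (cX / 2 - κ) * E := mul_le_mul_of_nonneg_right hc₀ hE0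
    _ = cX * E / 2 - κ * E := by ring
    _ ≤ _ := hgap

end

end Summit.QuantumFields.BalabanUV.T4Continuum.NE7CriticalOrbitQuadraticGrowthAnyDatum
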